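import Summits.RiemannHypothesis.RiemannHypothesis.Theorems.PfPersistenceParityTransport
import Summits.RiemannHypothesis.RiemannHypothesis.Theorems.WeilGroundStateGroundStateSimpleEvenTrialUpperH
import Summits.RiemannHypothesis.RiemannHypothesis.Theorems.SoloInformedNonDegenerate
import Literature.NumberTheory.LFunctions.WeilGroundEnergyParitySplit
import Literature.NumberTheory.LFunctions.WeilOddGroundState
import HarnessLib

/-!
# RATIO transport of the parity order from the PROVED frontier `2/3` — typed targets
# (pub-rhpf, transport-1 gen 2, leaf G1.22 'TRANSPORT', PF-persistence side; RH-free glue; def-free)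

**mechanism/rigidity campaign; no RH claims.**  Companion text:
`run/shared/lean/pub/pub-rhpf/pub-rhpf-transport-1/TRANSPORT.md` §9 (T-R).

Transport-1 gen 0 (`PfPersistenceParityTransport`) transported the parity SPLITTING `Q = ε_od − ε_ev`
(`weilOddGroundEnergy − weilEvenGroundEnergy`) with the archimedean rate `8π e^{2a}`: both sector bottoms
decay like `e^{−4π e^{2a}}` (DATA), so any additive transport of `Q` must carry that double-exponential
factor.  This file transports the parity RATIO instead.  In the quotient `ε_ev(a)/ε_od(a)` the universal
factor cancels, and the a-ladder DATA (TRANSPORT.md Table L7) shows the log-ratio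
`S(a) = lg(ε_od(a)/ε_ev(a))` RISING from `2.8` at `a = 2/3` to `5.4` at `a = 2.1` (slope `≈ +2.0` decades
per unit `a`), with local backslides of at most `0.103` decades.  The transport input is therefore a
BUDGET, not a rate:

* RATIO BUDGET `B` from the anchor `2/3` (hypothesis `hB` below, division-free):
  `ε_ev(b)·ε_od(2/3) ≤ B·ε_ev(2/3)·ε_od(b)` for every `b ≥ 2/3` at which `ε_od(b) > 0`, i.e.
  `S(b) ≥ S(2/3) − lg B` wherever the log-ratio is defined.

PROVED here (RH-free, from the landed cell certificates `trialUpperH : ε(2/3) ≤ 10⁻¹¹` and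
`oddLowerK67 : ε_od(2/3) ≥ 1/(2·10⁹)`): the SEED RATIO `50·ε_ev(2/3) ≤ ε_od(2/3)` (`S(2/3) ≥ lg 50 ≈ 1.70`),
so every budget `0 ≤ B < 50` is admissible (`budget_admissible`).  DATA: `B = 1.08` suffices on the served
ζ ladder `a ∈ [2/3, 2.1]` at `N = N_rule(a)` (all three engines; backslides persist at the `N − 20`
companions to within `0.01` decades, so they are features, not truncation artefacts).

CONSEQUENCES (all sorry-free, no new definitions):

* `even_lt_odd_of_ratioBudget` — the budget gives the strict parity order `ε_ev(b) < ε_od(b)` at every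
  window `b ≥ 2/3` WHERE THE ODD BOTTOM IS POSITIVE; equivalently (`odd_nonpos_of_parityTie_of_ratioBudget`)
  a parity tie or crossing at `b` forces `ε_od(b) ≤ 0` — PF persistence can fail no earlier than odd-sector
  Weil positivity.  This is the honest RH-free strength of the ratio transport.
* `parity_of_ratioBudget_of_riemannHypothesis` — under RH the odd bottom is positive at every window
  (`weilGroundEnergy_pos_of_riemannHypothesis`, Yoshida 1992 Thm 2 in variational form, landed), so the budget
  turns RH into the three PF items `NoParityCrossing` (stmt-18085), `GroundStateSimpleEven` (stmt-1526),
  `EvenWinsBeyondArch` (stmt-15432) BY NAME.  Without the budget RH is not known to give any of them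
  (Connes–Consani–Moscovici's "even and simple" is open under RH).
* `even_lt_odd_of_ratioAntitone` — the special case `B = 1` in pairwise form (PRO: the ratio
  `ε_ev/ε_od` non-increasing on the odd-positive part of `[2/3, ∞)`), which the DATA violate pointwise
  (dips of `≤ 0.08` decades per `0.01` step near prime-power onsets) but satisfy at every stride `≥ 0.1`.

Labels: `hB` / `hmono` are INPUTS (CONJ for ζ; DATA-consistent with a 16-fold margin in `lg B`); everything
else is PROVED tree material.  The served off-line controls violate the budget exactly where their bottom
parity flips (TRANSPORT.md Table L8); the input is RH-bearing through odd positivity only and is NOT known to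
imply RH (off RH the even bottom is eventually negative, `PolarPerronFrobenius.…le_neg_of_not_riemannHypothesis`,
which is consistent with the budget).  E1-shaped typed input (RULING A101 (a)); not a harness reader (A104).
-/

noncomputable section

set_option linter.dupNamespace false  -- D-0017 nested layout: `RiemannHypothesis.RiemannHypothesis`

namespace Summit.RiemannHypothesis.RiemannHypothesis.Theorems.PfPersistenceRatioTransport

open Set
open _root_.Literature.NumberTheory.LFunctions
open _root_.Summit.RiemannHypothesis.RiemannHypothesis.Theses.WeilParity (NoParityCrossing EvenWinsBeyondArch)
open _root_.Summit.RiemannHypothesis.RiemannHypothesis.Theses.WeilGroundState (GroundStateSimpleEven)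
open _root_.Summit.RiemannHypothesis.RiemannHypothesis.Theorems (trialUpperH oddLowerK67
  weilGroundEnergy_pos_of_riemannHypothesis)
open _root_.Summit.RiemannHypothesis.RiemannHypothesis.Theorems.EvenWinsBeyondArch
  (noParityCrossing_of_beyond_two_thirds groundStateSimpleEven_iff_noParityCrossingBeyond_two_thirds
    evenWinsBeyondArch_of_noTie_beyond_two_thirds)

/-! ## 1. The PROVED seed ratio at the frontier `2/3` -/

/-- **Odd bottom at `2/3` from below** (certificate K): `1/(2·10⁹) ≤ ε_od(2/3)`. [folklore] -/
theorem oddGroundEnergy_two_thirds_ge : (1 / 2000000000 : ℝ) ≤ weilOddGroundEnergy (2 / 3) :=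
  le_weilOddGroundEnergy_of_forall (by norm_num) fun g hg hs ho hn ↦ oddLowerK67 g hg hs hn ho

/-- The odd bottom at the frontier is positive. [folklore] -/
theorem oddGroundEnergy_two_thirds_pos : 0 < weilOddGroundEnergy (2 / 3) :=
  lt_of_lt_of_le (by norm_num) oddGroundEnergy_two_thirds_ge

/-- **Even bottom at `2/3` from above**: `ε_ev(2/3) ≤ 10⁻¹¹` (the Rayleigh–Ritz bound `trialUpperH` on
`ε = min(ε_ev, ε_od)` together with `ε_od(2/3) ≥ 1/(2·10⁹) > 10⁻¹¹`). [folklore] -/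
theorem evenGroundEnergy_two_thirds_le : weilEvenGroundEnergy (2 / 3) ≤ (1 / 100000000000 : ℝ) := by
  have hH : min (weilEvenGroundEnergy (2 / 3)) (weilOddGroundEnergy (2 / 3)) ≤ (1 / 100000000000 : ℝ) := by
    rw [← weilGroundEnergy_eq_min_even_odd]; exact trialUpperH
  have hodd := oddGroundEnergy_two_thirds_ge
  rcases min_le_iff.1 hH with h | h
  · exact h
  · linarith

/-- **PROVED SEED RATIO**: `50·ε_ev(2/3) ≤ ε_od(2/3)`, i.e. `S(2/3) = lg(ε_od/ε_ev)(2/3) ≥ lg 50` (when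
`ε_ev(2/3) > 0`; if `ε_ev(2/3) ≤ 0` the inequality is trivial). [folklore] -/
theorem ratio_seed_two_thirds : 50 * weilEvenGroundEnergy (2 / 3) ≤ weilOddGroundEnergy (2 / 3) := by
  have h1 := evenGroundEnergy_two_thirds_le
  have h2 := oddGroundEnergy_two_thirds_ge
  linarith

/-- **Every budget `0 ≤ B < 50` is admissible at the seed**: `B·ε_ev(2/3) < ε_od(2/3)`. [folklore] -/
theorem budget_admissible {B : ℝ} (hB0 : 0 ≤ B) (hB : B < 50) :
    B * weilEvenGroundEnergy (2 / 3) < weilOddGroundEnergy (2 / 3) := by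
  have h1 := evenGroundEnergy_two_thirds_le
  have h2 := oddGroundEnergy_two_thirds_ge
  rcases le_or_gt (weilEvenGroundEnergy (2 / 3)) 0 with h | h
  · have : B * weilEvenGroundEnergy (2 / 3) ≤ 0 := mul_nonpos_of_nonneg_of_nonpos hB0 h
    linarith
  · have : B * weilEvenGroundEnergy (2 / 3) < 50 * weilEvenGroundEnergy (2 / 3) :=
      mul_lt_mul_of_pos_right hB h
    linarith

/-! ## 2. Ratio budget from the anchor ⟹ strict parity order on the odd-positive region -/

/-- **Ratio transport of the parity order (RH-free form).**  If `B·ε_ev(2/3) < ε_od(2/3)` (any `0 ≤ B < 50`,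
`budget_admissible`) and the RATIO BUDGET `ε_ev(b)·ε_od(2/3) ≤ B·ε_ev(2/3)·ε_od(b)` holds at every `b ≥ 2/3`
with `ε_od(b) > 0`, then `ε_ev(b) < ε_od(b)` at every such `b`: the Perron–Frobenius order persists on the
whole odd-positive part of `[2/3, ∞)`. [folklore] -/
theorem even_lt_odd_of_ratioBudget {B : ℝ}
    (hseed : B * weilEvenGroundEnergy (2 / 3) < weilOddGroundEnergy (2 / 3))
    (hB : ∀ b : ℝ, 2 / 3 ≤ b → 0 < weilOddGroundEnergy b →
      weilEvenGroundEnergy b * weilOddGroundEnergy (2 / 3) ≤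
        B * (weilEvenGroundEnergy (2 / 3) * weilOddGroundEnergy b)) :
    ∀ b : ℝ, 2 / 3 ≤ b → 0 < weilOddGroundEnergy b → weilEvenGroundEnergy b < weilOddGroundEnergy b := by
  intro b hb hodd
  have hpos := oddGroundEnergy_two_thirds_pos
  have key := hB b hb hodd
  have hlt : B * (weilEvenGroundEnergy (2 / 3) * weilOddGroundEnergy b) <
      weilOddGroundEnergy (2 / 3) * weilOddGroundEnergy b := by
    have := mul_lt_mul_of_pos_right hseed hodd
    linarith [mul_assoc B (weilEvenGroundEnergy (2 / 3)) (weilOddGroundEnergy b)]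
  have h3 : weilEvenGroundEnergy b * weilOddGroundEnergy (2 / 3) <
      weilOddGroundEnergy b * weilOddGroundEnergy (2 / 3) := by
    linarith [mul_comm (weilOddGroundEnergy (2 / 3)) (weilOddGroundEnergy b)]
  exact lt_of_mul_lt_mul_right h3 hpos.le

/-- **Contrapositive: a parity tie or crossing forces a non-positive odd bottom.**  Under the ratio budget,
`ε_od(b) ≤ ε_ev(b)` at some `b ≥ 2/3` implies `ε_od(b) ≤ 0` (hence `ε(b) ≤ 0`): the first failure of PF
persistence cannot precede the first failure of odd-sector Weil positivity. [folklore] -/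
theorem odd_nonpos_of_parityTie_of_ratioBudget {B : ℝ}
    (hseed : B * weilEvenGroundEnergy (2 / 3) < weilOddGroundEnergy (2 / 3))
    (hB : ∀ b : ℝ, 2 / 3 ≤ b → 0 < weilOddGroundEnergy b →
      weilEvenGroundEnergy b * weilOddGroundEnergy (2 / 3) ≤
        B * (weilEvenGroundEnergy (2 / 3) * weilOddGroundEnergy b))
    {b : ℝ} (hb : 2 / 3 ≤ b) (htie : weilOddGroundEnergy b ≤ weilEvenGroundEnergy b) :
    weilOddGroundEnergy b ≤ 0 ∧ weilGroundEnergy b ≤ 0 := by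
  have hodd : weilOddGroundEnergy b ≤ 0 := by
    by_contra h
    exact absurd htie (not_le.2 (even_lt_odd_of_ratioBudget hseed hB b hb (not_le.1 h)))
  exact ⟨hodd, (weilGroundEnergy_le_weilOddGroundEnergy b).trans hodd⟩

/-- **Ratio budget ⟹ (RH ⟹ the three PF items).**  Under RH every window form is uniformly positive
definite (`weilGroundEnergy_pos_of_riemannHypothesis`), so `ε_od(b) ≥ ε(b) > 0` everywhere and the budget
gives the strict order beyond `2/3`; the landed `Frontier67` reductions then give `NoParityCrossing`
(stmt-18085), `GroundStateSimpleEven` (stmt-1526) and `EvenWinsBeyondArch` (stmt-15432) BY NAME.  CONDITIONAL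
on RH and on the budget; no RH claim. [folklore] -/
theorem parity_of_ratioBudget_of_riemannHypothesis {B : ℝ}
    (hseed : B * weilEvenGroundEnergy (2 / 3) < weilOddGroundEnergy (2 / 3))
    (hB : ∀ b : ℝ, 2 / 3 ≤ b → 0 < weilOddGroundEnergy b →
      weilEvenGroundEnergy b * weilOddGroundEnergy (2 / 3) ≤
        B * (weilEvenGroundEnergy (2 / 3) * weilOddGroundEnergy b))
    (hRH : RiemannHypothesis) :
    NoParityCrossing ∧ GroundStateSimpleEven ∧ EvenWinsBeyondArch := by
  have hlt : ∀ b : ℝ, 2 / 3 < b → weilEvenGroundEnergy b < weilOddGroundEnergy b := fun b hb ↦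
    even_lt_odd_of_ratioBudget hseed hB b hb.le
      ((weilGroundEnergy_pos_of_riemannHypothesis hRH (lt_trans (by norm_num) hb)).trans_le
        (weilGroundEnergy_le_weilOddGroundEnergy b))
  exact ⟨noParityCrossing_of_beyond_two_thirds fun b hb ↦ ne_of_lt (hlt b hb),
    groundStateSimpleEven_iff_noParityCrossingBeyond_two_thirds.2 fun b hb ↦ ne_of_lt (hlt b hb),
    evenWinsBeyondArch_of_noTie_beyond_two_thirds fun b hb ↦ ne_of_lt (hlt b hb)⟩

/-- **The same with the PROVED admissibility folded in**: any budget `0 ≤ B < 50`. [folklore] -/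
theorem parity_of_ratioBudget_lt_fifty_of_riemannHypothesis {B : ℝ} (hB0 : 0 ≤ B) (hB50 : B < 50)
    (hB : ∀ b : ℝ, 2 / 3 ≤ b → 0 < weilOddGroundEnergy b →
      weilEvenGroundEnergy b * weilOddGroundEnergy (2 / 3) ≤
        B * (weilEvenGroundEnergy (2 / 3) * weilOddGroundEnergy b))
    (hRH : RiemannHypothesis) :
    NoParityCrossing ∧ GroundStateSimpleEven ∧ EvenWinsBeyondArch :=
  parity_of_ratioBudget_of_riemannHypothesis (budget_admissible hB0 hB50) hB hRH

/-! ## 3. The antitone special case `B = 1` (PRO, pairwise form) -/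

/-- **PRO (parity-ratio ordering) ⟹ strict order on the odd-positive region.**  If the ratio `ε_ev/ε_od`
is non-increasing along the odd-positive part of `[2/3, ∞)` in the division-free pairwise form
`ε_ev(b)·ε_od(a) ≤ ε_ev(a)·ε_od(b)` (`2/3 ≤ a ≤ b`, `ε_od(a), ε_od(b) > 0`), then `ε_ev(b) < ε_od(b)` wherever
`ε_od(b) > 0`, `b ≥ 2/3` (budget `B = 1`). [folklore] -/
theorem even_lt_odd_of_ratioAntitone
    (hmono : ∀ a b : ℝ, 2 / 3 ≤ a → a ≤ b → 0 < weilOddGroundEnergy a → 0 < weilOddGroundEnergy b →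
      weilEvenGroundEnergy b * weilOddGroundEnergy a ≤ weilEvenGroundEnergy a * weilOddGroundEnergy b) :
    ∀ b : ℝ, 2 / 3 ≤ b → 0 < weilOddGroundEnergy b → weilEvenGroundEnergy b < weilOddGroundEnergy b := by
  refine even_lt_odd_of_ratioBudget (B := 1) (by simpa using budget_admissible zero_le_one (by norm_num)) ?_
  intro b hb hodd
  simpa using hmono (2 / 3) b le_rfl hb oddGroundEnergy_two_thirds_pos hodd

/-- **PRO ⟹ (RH ⟹ the three PF items).** [folklore] -/
theorem parity_of_ratioAntitone_of_riemannHypothesis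
    (hmono : ∀ a b : ℝ, 2 / 3 ≤ a → a ≤ b → 0 < weilOddGroundEnergy a → 0 < weilOddGroundEnergy b →
      weilEvenGroundEnergy b * weilOddGroundEnergy a ≤ weilEvenGroundEnergy a * weilOddGroundEnergy b)
    (hRH : RiemannHypothesis) :
    NoParityCrossing ∧ GroundStateSimpleEven ∧ EvenWinsBeyondArch := by
  refine parity_of_ratioBudget_of_riemannHypothesis (B := 1)
    (by simpa using budget_admissible zero_le_one (by norm_num)) ?_ hRH
  intro b hb hodd
  simpa using hmono (2 / 3) b le_rfl hb oddGroundEnergy_two_thirds_pos hodd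

end Summit.RiemannHypothesis.RiemannHypothesis.Theorems.PfPersistenceRatioTransport

end
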